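import Mathlib
import HarnessLib
import Summits.HubbardSuperconductivity.HubbardSuperconductivity.Theorems.KLProgrammeForwardBubbleSoftPartner
import Summits.HubbardSuperconductivity.HubbardSuperconductivity.Theorems.KLProgrammeForwardBubbleSoft

/-!
# Route `KLProgramme` — ENGINE item stmt-HubbardSuperconductivity-20437 `KLRegimeEngineV17F2`, class-#5 STEP (X).3 pinned pair «88b» /
# located-risk #14 «(X).3-PINNED-NUMERIC», factor (γ)-TR: the joint Lipschitz constant of the slice propagator by a RADIAL PATH argument
# (`3L_f + M_f/r₁²` in place of `(1 + r₂/r₁)L_f + M_f/r₁²`), the cut partner's constant `(3ℓ′ + 512M_f′)/Λ²` (in place of `(65ℓ′ + 17408M_f′/3)/Λ²`),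
# and the transfer shift with the Matsubara count SPLIT into its flat and thermal parts
# (cell gate-hubbard-kl, seat hubbard-kl-k3c2-p2 g22, technique «thermal-bar induction n ≤ nScales β + 1 with EngineBoundsAtV4S sums»)

WHY.  In the pinned-pair pricing (k3c1 CLASS5-RESOLVED-STEP §17) the binding entry after (γ)-ZS is the TRANSFER piece
`TR⋆ = (256/π)·M_f·B_W·K′Λ²` with `K′Λ² = 65ℓ′ + 17408M_f′/3` (`klfp_prop_cutWeight_lipschitz` ← `klsq_propagator_lipschitz` at `r₁ = Λ/16`, `r₂ = 4Λ`).
Two independent factors are loose: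
* the factor `65 = 1 + r₂/r₁` is the far-pair worst case `(|p| + |p′|)/|p|` of the global Lipschitz bound; a radial comparison (`f(r₁²) = 0` ⇒
  `‖f(|z|²)‖/|z| ≤ L_f·|z|`, and for comparable radii `|z′| < 2|z|` the difference quotient is `< 3L_f`) gives **`3L_f + M_f/r₁²`** for ALL pairs
  (`klsq_weight_div_lipschitz_path`, `klsq_propagator_lipschitz_path`), hence the cut partner's **`K′ = (3ℓ′ + 512M_f′)/Λ²`**
  (`klfp_prop_cutWeight_lipschitz_path`; `j = n+2`: `896/Λ²` against `14123/Λ²`, a factor `2^3.98`);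
* the Matsubara count `4Λ/π + 3/β ≤ 16Λ/π` (`klsp_count_factor_le`) books the thermal part `3/β` into the n-FLAT transfer slot; keeping the two parts
  separate (**`klfs_shift_norm_le_of_lipschitz_split`**: `(64/π)·M_f·B_W·(K′Λ)·D + (48/π)·M_f·B_W·(K′Λ)·D·((π/β)/Λ)`) divides the flat entry by `4`
  and moves the rest to a `thermalBar`-shaped monomial.
Pure analysis on the tree's objects; nothing about the model is asserted; nothing asserts (X).3, (c), K3 or superconductivity.
References: BGM 2006 §2.5 (2.56b)–(2.56e) [cite: BenfattoGiulianiMastropietro2006].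
-/

noncomputable section

namespace Summit.HubbardSuperconductivity.HubbardSuperconductivity.Theorems.KLRegimeSplit

set_option linter.dupNamespace false -- summit = problem name (single-conjunct summit), D-0017

open Real Set Filter MeasureTheory intervalIntegral Complex Literature.MathematicalPhysics.QuantumLattice
open Literature.MathematicalPhysics.QuantumLattice.BandSectorCounting Literature.Probability.LatticeModels
open Summit.HubbardSuperconductivity.HubbardSuperconductivity.Theorems.PerturbedFermiCurve
open Summit.HubbardSuperconductivity.HubbardSuperconductivity.Theorems.KLProgrammeLegKernels

/-! ## §1 The radial path bound for `z ↦ f(|z|²)·z⁻¹` -/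

section Path

variable {f : ℝ → ℂ} {Lf Mf r₁ : ℝ}

/-- Radial vanishing: `‖f(‖z‖²)·z⁻¹‖ ≤ L_f·‖z‖` (`f(s) = 0` for `s ≤ r₁²`, `f` `L_f`-Lipschitz): `‖f(t²)‖ ≤ L_f(t² − r₁²) ≤ L_f·t²`. -/
theorem klsq_weight_div_norm_le_lin (hlip : ∀ s s', ‖f s - f s'‖ ≤ Lf * |s - s'|) (hin : ∀ s, s ≤ r₁ ^ 2 → f s = 0) (z : ℂ) :
    ‖f (‖z‖ ^ 2) * z⁻¹‖ ≤ Lf * ‖z‖ := by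
  have hLf : 0 ≤ Lf := by
    have := hlip 0 1; have h0 : (0:ℝ) ≤ ‖f 0 - f 1‖ := norm_nonneg _; norm_num at this; linarith
  rcases le_or_gt (‖z‖ ^ 2) (r₁ ^ 2) with hs | hs
  · rw [hin _ hs, zero_mul, norm_zero]; positivity
  · have hz : 0 < ‖z‖ := by
      by_contra h
      have h0 : ‖z‖ = 0 := le_antisymm (not_lt.mp h) (norm_nonneg _)
      rw [h0] at hs
      nlinarith [sq_nonneg r₁]
    have h := hlip (‖z‖ ^ 2) (r₁ ^ 2)
    rw [hin _ le_rfl, sub_zero, abs_of_pos (by linarith)] at h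
    rw [norm_mul, norm_inv]
    rw [mul_inv_le_iff₀ hz]
    calc ‖f (‖z‖ ^ 2)‖ ≤ Lf * (‖z‖ ^ 2 - r₁ ^ 2) := h
      _ ≤ Lf * ‖z‖ * ‖z‖ := by nlinarith [sq_nonneg r₁]

/-- Radial vanishing, gap form: if `r₁ ≤ ‖z‖` (`0 < r₁`) then `‖f(‖z‖²)·z⁻¹‖ ≤ 2L_f·(‖z‖ − r₁)`. -/
theorem klsq_weight_div_norm_le_gap (hlip : ∀ s s', ‖f s - f s'‖ ≤ Lf * |s - s'|) (hin : ∀ s, s ≤ r₁ ^ 2 → f s = 0) (hr₁ : 0 < r₁)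
    {z : ℂ} (hz : r₁ ≤ ‖z‖) : ‖f (‖z‖ ^ 2) * z⁻¹‖ ≤ 2 * Lf * (‖z‖ - r₁) := by
  have hLf : 0 ≤ Lf := by
    have := hlip 0 1; have h0 : (0:ℝ) ≤ ‖f 0 - f 1‖ := norm_nonneg _; norm_num at this; linarith
  have hzpos : 0 < ‖z‖ := lt_of_lt_of_le hr₁ hz
  have h := hlip (‖z‖ ^ 2) (r₁ ^ 2)
  rw [hin _ le_rfl, sub_zero, abs_of_nonneg (by nlinarith)] at h
  rw [norm_mul, norm_inv, mul_inv_le_iff₀ hzpos]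
  calc ‖f (‖z‖ ^ 2)‖ ≤ Lf * (‖z‖ ^ 2 - r₁ ^ 2) := h
    _ = Lf * (‖z‖ - r₁) * (‖z‖ + r₁) := by ring
    _ ≤ Lf * (‖z‖ - r₁) * (2 * ‖z‖) := by
        exact mul_le_mul_of_nonneg_left (by linarith) (by nlinarith)
    _ = 2 * Lf * (‖z‖ - r₁) * ‖z‖ := by ring

/-- **The radial-path Lipschitz bound.**  For a shell weight `f : ℝ → ℂ` (`L_f`-Lipschitz in `s`, `‖f‖ ≤ M_f`, `f(s) = 0` for `s ≤ r₁²`, `0 < r₁`) the map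
`z ↦ f(‖z‖²)·z⁻¹` is `(3L_f + M_f/r₁²)`-Lipschitz on `ℂ`:  far pairs (`2‖z‖ ≤ ‖z′‖`) by radial vanishing (`≤ L_f(‖z‖ + ‖z′‖) ≤ 3L_f‖z − z′‖`), mixed pairs
(one point in the inner disc) by the gap form (`≤ 2L_f(‖z′‖ − r₁) ≤ 2L_f‖z − z′‖`), comparable pairs outside the inner disc by
`(f(s) − f(s′))z⁻¹ + f(s′)(z⁻¹ − z′⁻¹)` (`≤ L_f|s − s′|/‖z‖ + M_f‖z − z′‖/(‖z‖‖z′‖) ≤ (3L_f + M_f/r₁²)‖z − z′‖`). -/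
theorem klsq_weight_div_lipschitz_path (hlip : ∀ s s', ‖f s - f s'‖ ≤ Lf * |s - s'|) (hbd : ∀ s, ‖f s‖ ≤ Mf)
    (hin : ∀ s, s ≤ r₁ ^ 2 → f s = 0) (hr₁ : 0 < r₁) (z z' : ℂ) :
    ‖f (‖z‖ ^ 2) * z⁻¹ - f (‖z'‖ ^ 2) * z'⁻¹‖ ≤ (3 * Lf + Mf / r₁ ^ 2) * ‖z - z'‖ := by
  have hLf : 0 ≤ Lf := by
    have := hlip 0 1; have h0 : (0:ℝ) ≤ ‖f 0 - f 1‖ := norm_nonneg _; norm_num at this; linarith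
  have hMf : 0 ≤ Mf := (norm_nonneg _).trans (hbd 0)
  have hK2 : 0 ≤ Mf / r₁ ^ 2 := by positivity
  set t := ‖z‖ with ht
  set t' := ‖z'‖ with ht'
  have ht0 : 0 ≤ t := norm_nonneg _
  have ht'0 : 0 ≤ t' := norm_nonneg _
  set d := ‖z - z'‖ with hd
  have hd0 : 0 ≤ d := norm_nonneg _
  -- the radii are `d`-close
  have htt' : |t - t'| ≤ d := abs_norm_sub_norm_le z z'
  have h1 : t - t' ≤ d := (le_abs_self _).trans htt'
  have h2 : t' - t ≤ d := by rw [abs_sub_comm] at htt'; exact (le_abs_self _).trans htt'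
  -- the target with room
  have goal_of : ∀ {y x : ℝ}, x ≤ 3 * Lf * d → y ≤ x → y ≤ (3 * Lf + Mf / r₁ ^ 2) * d := by
    intro y x hx h
    refine h.trans (hx.trans ?_)
    nlinarith
  by_cases hs : t ^ 2 ≤ r₁ ^ 2
  · by_cases hs' : t' ^ 2 ≤ r₁ ^ 2
    · -- both in the inner disc
      rw [hin _ hs, hin _ hs', zero_mul, zero_mul, sub_zero, norm_zero]; positivity
    · -- `z` inside, `z'` outside the inner disc: gap form at `z'`
      have htr : t ≤ r₁ := by nlinarith
      have ht'r : r₁ ≤ t' := by nlinarith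
      rw [hin _ hs, zero_mul, zero_sub, norm_neg]
      refine goal_of (x := 2 * Lf * (t' - r₁)) (by nlinarith) ?_
      exact klsq_weight_div_norm_le_gap hlip hin hr₁ ht'r
  · by_cases hs' : t' ^ 2 ≤ r₁ ^ 2
    · -- symmetric mixed case: gap form at `z`
      have ht'r : t' ≤ r₁ := by nlinarith
      have htr : r₁ ≤ t := by nlinarith
      rw [hin _ hs', zero_mul, sub_zero]
      refine goal_of (x := 2 * Lf * (t - r₁)) (by nlinarith) ?_
      exact klsq_weight_div_norm_le_gap hlip hin hr₁ htr
    · -- both outside the inner disc: `t, t' > r₁`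
      have htr : r₁ < t := by nlinarith
      have ht'r : r₁ < t' := by nlinarith
      have htpos : 0 < t := hr₁.trans htr
      have ht'pos : 0 < t' := hr₁.trans ht'r
      by_cases hfar : 2 * t ≤ t' ∨ 2 * t' ≤ t
      · -- far pair: radial vanishing at both points, `t + t' ≤ 3d`
        have hsum : Lf * t + Lf * t' ≤ 3 * Lf * d := by
          rcases hfar with h | h
          · have : t ≤ d := by linarith
            have : t' ≤ 2 * d := by linarith
            nlinarith
          · have : t' ≤ d := by linarith
            have : t ≤ 2 * d := by linarith
            nlinarith
        refine goal_of (x := Lf * t + Lf * t') hsum ?_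
        exact (norm_sub_le _ _).trans (add_le_add (klsq_weight_div_norm_le_lin hlip hin z) (klsq_weight_div_norm_le_lin hlip hin z'))
      · -- comparable pair: `t' < 2t`, `t < 2t'`
        push Not at hfar
        obtain ⟨hc1, hc2⟩ := hfar
        have hz0 : z ≠ 0 := by intro h; rw [h, norm_zero] at ht; linarith
        have hz'0 : z' ≠ 0 := by intro h; rw [h, norm_zero] at ht'; linarith
        have hsplit : f (t ^ 2) * z⁻¹ - f (t' ^ 2) * z'⁻¹ = (f (t ^ 2) - f (t' ^ 2)) * z⁻¹ + f (t' ^ 2) * (z⁻¹ - z'⁻¹) := by ring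
        rw [hsplit]
        -- first piece: `L_f |t² − t'²| / t ≤ L_f · d · (t + t')/t < 3 L_f d`
        have hA : ‖(f (t ^ 2) - f (t' ^ 2)) * z⁻¹‖ ≤ 3 * Lf * d := by
          rw [norm_mul, norm_inv, ← ht]
          have hf := hlip (t ^ 2) (t' ^ 2)
          have habs : |t ^ 2 - t' ^ 2| ≤ d * (t + t') := by
            rw [show t ^ 2 - t' ^ 2 = (t - t') * (t + t') by ring, abs_mul, abs_of_nonneg (by positivity : 0 ≤ t + t')]
            exact mul_le_mul_of_nonneg_right htt' (by positivity)
          rw [mul_inv_le_iff₀ htpos]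
          calc ‖f (t ^ 2) - f (t' ^ 2)‖ ≤ Lf * |t ^ 2 - t' ^ 2| := hf
            _ ≤ Lf * (d * (t + t')) := mul_le_mul_of_nonneg_left habs hLf
            _ ≤ 3 * Lf * d * t := by nlinarith [mul_nonneg hLf hd0]
        -- second piece: `M_f · ‖z − z'‖/(t t') ≤ (M_f/r₁²) d`
        have hB : ‖f (t' ^ 2) * (z⁻¹ - z'⁻¹)‖ ≤ Mf / r₁ ^ 2 * d := by
          rw [norm_mul]
          have hinv : z⁻¹ - z'⁻¹ = (z' - z) * (z⁻¹ * z'⁻¹) := by field_simp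
          have hnorm : ‖z⁻¹ - z'⁻¹‖ = d * (t⁻¹ * t'⁻¹) := by
            rw [hinv, norm_mul, norm_mul, norm_inv, norm_inv, norm_sub_rev]
          rw [hnorm]
          have htt : r₁ ^ 2 ≤ t * t' := by nlinarith
          calc ‖f (t' ^ 2)‖ * (d * (t⁻¹ * t'⁻¹)) ≤ Mf * (d * (t⁻¹ * t'⁻¹)) :=
                mul_le_mul_of_nonneg_right (hbd _) (by positivity)
            _ = Mf * d / (t * t') := by field_simp
            _ ≤ Mf * d / r₁ ^ 2 := by
                exact div_le_div_of_nonneg_left (by positivity) (by positivity) htt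
            _ = Mf / r₁ ^ 2 * d := by ring
        calc ‖(f (t ^ 2) - f (t' ^ 2)) * z⁻¹ + f (t' ^ 2) * (z⁻¹ - z'⁻¹)‖
            ≤ ‖(f (t ^ 2) - f (t' ^ 2)) * z⁻¹‖ + ‖f (t' ^ 2) * (z⁻¹ - z'⁻¹)‖ := norm_add_le _ _
          _ ≤ 3 * Lf * d + Mf / r₁ ^ 2 * d := add_le_add hA hB
          _ = (3 * Lf + Mf / r₁ ^ 2) * d := by ring

/-- **The radial-path joint Lipschitz bound of the slice propagator** (`Φ(k₀,e) = f(k₀²+e²)·(−ik₀+e)⁻¹`; compare `klsq_propagator_lipschitz`'s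
`(1 + r₂/r₁)L_f + M_f/r₁²`): for ALL `(k₀,e), (k₀',e')`, `‖Φ(k₀,e) − Φ(k₀',e')‖ ≤ (3L_f + M_f/r₁²)·(|k₀ − k₀'| + |e − e'|)`.  No outer radius is needed. -/
theorem klsq_propagator_lipschitz_path (hlip : ∀ s s', ‖f s - f s'‖ ≤ Lf * |s - s'|) (hbd : ∀ s, ‖f s‖ ≤ Mf)
    (hin : ∀ s, s ≤ r₁ ^ 2 → f s = 0) (hr₁ : 0 < r₁) (k₀ e k₀' e' : ℝ) :
    ‖f (k₀ ^ 2 + e ^ 2) * (-I * k₀ + e)⁻¹ - f (k₀' ^ 2 + e' ^ 2) * (-I * k₀' + e')⁻¹‖ ≤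
      (3 * Lf + Mf / r₁ ^ 2) * (|k₀ - k₀'| + |e - e'|) := by
  have hLf : 0 ≤ Lf := by
    have := hlip 0 1; have h0 : (0:ℝ) ≤ ‖f 0 - f 1‖ := norm_nonneg _; norm_num at this; linarith
  have hMf : 0 ≤ Mf := (norm_nonneg _).trans (hbd 0)
  have hz : ‖(-I * k₀ + e : ℂ)‖ ^ 2 = k₀ ^ 2 + e ^ 2 := by
    rw [klsq_norm_conj_lin, Real.sq_sqrt (by positivity)]
  have hz' : ‖(-I * k₀' + e' : ℂ)‖ ^ 2 = k₀' ^ 2 + e' ^ 2 := by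
    rw [klsq_norm_conj_lin, Real.sq_sqrt (by positivity)]
  have h := klsq_weight_div_lipschitz_path hlip hbd hin hr₁ (-I * k₀ + e) (-I * k₀' + e')
  rw [hz, hz'] at h
  refine h.trans (mul_le_mul_of_nonneg_left (klsq_norm_conj_lin_sub_le k₀ e k₀' e') (by positivity))

end Path

/-! ## §2 The cut partner's joint Lipschitz constant, path form -/

section CutWeight

variable {f' : ℝ → ℂ} {Lf' Mf' : ℝ}

/-- **Joint Lipschitz constant of the cut propagator, path form** at scale `n` (`L_f' ≤ ℓ'/Λ_n²`; the cut `klfp_cut Λ_n` vanishes below `(Λ_n/16)²` and is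
`256/(3Λ_n²)`-Lipschitz): `K' = (3ℓ' + 512M_f')/Λ_n²` (`klsq_propagator_lipschitz_path` at `r₁ = Λ_n/16`: `3(L_f' + 256M_f'/(3Λ²)) + 256M_f'/Λ²`).
Compare `klfp_prop_cutWeight_lipschitz`'s `(65ℓ' + 17408M_f'/3)/Λ_n²`. -/
theorem klfp_prop_cutWeight_lipschitz_path {ℓ' : ℝ} (hlip' : ∀ s s', ‖f' s - f' s'‖ ≤ Lf' * |s - s'|) (hbd' : ∀ s, ‖f' s‖ ≤ Mf') {n : ℕ}
    (hLf' : Lf' ≤ ℓ' / klScale klE0 n ^ 2) (k₀ e k₀' e' : ℝ) :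
    ‖klfb_prop (fun s => f' s * (klfp_cut (klScale klE0 n) s : ℂ)) k₀ e -
        klfb_prop (fun s => f' s * (klfp_cut (klScale klE0 n) s : ℂ)) k₀' e'‖ ≤
      (3 * ℓ' + 512 * Mf') / klScale klE0 n ^ 2 * (|k₀ - k₀'| + |e - e'|) := by
  set Λ := klScale klE0 n with hΛdef
  have hΛ : 0 < Λ := klth_klScale_pos n
  have hMf' : 0 ≤ Mf' := (norm_nonneg _).trans (hbd' 0)
  have hLf'0 : 0 ≤ Lf' := by
    have := hlip' 0 1; norm_num at this; linarith [norm_nonneg (f' 0 - f' 1)]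
  unfold klfb_prop
  rw [klsp_div_propagator_eq (fun s => f' s * (klfp_cut Λ s : ℂ)) k₀ e, klsp_div_propagator_eq (fun s => f' s * (klfp_cut Λ s : ℂ)) k₀' e']
  have h := klsq_propagator_lipschitz_path (f := fun s => f' s * (klfp_cut Λ s : ℂ)) (klfp_cutWeight_lipschitz hlip' hbd' Λ)
    (klfp_cutWeight_norm_le hbd' Λ) (fun s hs => klfp_cutWeight_eq_zero_of_le hs) (by positivity : 0 < Λ / 16) k₀ e k₀' e'
  refine h.trans (mul_le_mul_of_nonneg_right ?_ (by positivity))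
  have hL : 3 * (Lf' + Mf' * (256 / (3 * Λ ^ 2))) ≤ 3 * (ℓ' / Λ ^ 2 + Mf' * (256 / (3 * Λ ^ 2))) := by
    have := add_le_add_right hLf' (Mf' * (256 / (3 * Λ ^ 2))); nlinarith
  calc 3 * (Lf' + Mf' * (256 / (3 * Λ ^ 2))) + Mf' / (Λ / 16) ^ 2
      ≤ 3 * (ℓ' / Λ ^ 2 + Mf' * (256 / (3 * Λ ^ 2))) + Mf' / (Λ / 16) ^ 2 := by linarith
    _ = (3 * ℓ' + 512 * Mf') / Λ ^ 2 := by field_simp; ring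

/-- **The gain, as a number** (`j = n+2`: `ℓ' = 128`, `M_f' = 1`): `(3·128 + 512)·15 ≤ 65·128 + 17408/3`, i.e. the path constant `896` is below the
constant of record `14123` by more than the factor `15` (`2^3.9`). -/
theorem klfp_cutWeight_path_gain : ((3 : ℝ) * 128 + 512) * 15 ≤ 65 * 128 + 17408 / 3 := by norm_num

end CutWeight

/-! ## §3 The transfer shift with the Matsubara count split into its flat and thermal parts -/

section Shift
variable {f : ℝ → ℂ} {Mf : ℝ} {Ψ : ℝ → ℝ → ℂ} {K' : ℝ} {W : ℝ → ℂ} {δ : ℝ → ℝ} {BW δmax : ℝ}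

/-- **Transfer shift, second propagator abstract, Matsubara count SPLIT.**  As `klfs_shift_norm_le_of_lipschitz` but the count factor
`4Λ_n/π + 3/β` of `klsp_discrete_perturb_norm_le` is NOT merged into `16Λ_n/π`:
`‖β⁻¹•Σ_i ∫ W(e)Φ_f(ω_i,e)(Ψ(ω_i+q₀, e+δ(e)) − Ψ(ω_i,e)) de‖ ≤ (64/π)·M_f·B_W·(K'·Λ_n)·(|q₀| + δ_max) + (48/π)·M_f·B_W·(K'·Λ_n)·(|q₀| + δ_max)·((π/β)/Λ_n)`
— the first (n-flat) piece is a quarter of the merged constant `256/π`; the second is a `thermalBar`-shaped monomial.  Any `β > 0`, any `M`. -/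
theorem klfs_shift_norm_le_of_lipschitz_split (hbd : ∀ s, ‖f s‖ ≤ Mf) {n : ℕ}
    (hin : ∀ s, s ≤ (klScale klE0 n / 2) ^ 2 → f s = 0) (hout : ∀ s, (4 * klScale klE0 n) ^ 2 ≤ s → f s = 0)
    (hK' : 0 ≤ K') (hΨlip : ∀ k₀ e k₀' e', ‖Ψ k₀ e - Ψ k₀' e'‖ ≤ K' * (|k₀ - k₀'| + |e - e'|))
    (hBW : 0 ≤ BW) (hWbd : ∀ e, |e| < 4 * klScale klE0 n → ‖W e‖ ≤ BW) (hδ0 : 0 ≤ δmax) (hδ : ∀ e, |δ e| ≤ δmax)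
    (q₀ : ℝ) {β : ℝ} (hβ : 0 < β) (M : ℕ) :
    ‖β⁻¹ • ∑ i : MatsubaraIdx M, ∫ e,
        W e * klfb_prop f (matsubaraFreq β M i) e * (Ψ (matsubaraFreq β M i + q₀) (e + δ e) - Ψ (matsubaraFreq β M i) e)‖ ≤
      64 / Real.pi * Mf * BW * (K' * klScale klE0 n) * (|q₀| + δmax) +
        48 / Real.pi * Mf * BW * (K' * klScale klE0 n) * (|q₀| + δmax) * ((Real.pi / β) / klScale klE0 n) := by
  set Λ := klScale klE0 n with hΛdef
  have hΛ : 0 < Λ := klth_klScale_pos n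
  have hMf : 0 ≤ Mf := (norm_nonneg _).trans (hbd 0)
  have hr₁ : 0 < Λ / 2 := by positivity
  have hr : 0 < 4 * Λ := by positivity
  have hgsupp : ∀ s, (4 * Λ) ^ 2 ≤ s → (fun s : ℝ => f s / ((s : ℝ) : ℂ)) s = 0 := fun s hs => by simp only [hout s hs, zero_div]
  set A : ℝ := Mf / (Λ / 2) with hA
  have hA0 : 0 ≤ A := by positivity
  set D : ℝ := |q₀| + δmax with hD
  have main := klsp_discrete_perturb_norm_le
    (Φ := fun k₀ e => f (k₀ ^ 2 + e ^ 2) / (((k₀ ^ 2 + e ^ 2 : ℝ)) : ℂ) * (I * k₀ + e)) (Ψ := Ψ) (W := W) (δ := δ)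
    hA0 hK' hBW hr.le hδ0
    (fun k₀ e => klsp_div_propagator_norm_le hbd hin hr₁ k₀ e)
    (fun k₀ hk e => klsp_zero_of_le_abs_fst hgsupp hr.le hk e)
    (fun k₀ e he => klsp_zero_of_le_abs_snd hgsupp hr.le k₀ he)
    hΨlip hWbd hδ q₀ hβ M
  have hform : (β⁻¹ • ∑ i : MatsubaraIdx M, ∫ e,
      W e * klfb_prop f (matsubaraFreq β M i) e * (Ψ (matsubaraFreq β M i + q₀) (e + δ e) - Ψ (matsubaraFreq β M i) e)) =
      β⁻¹ • ∑ i : MatsubaraIdx M, ∫ e, W e *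
        (fun k₀ e => f (k₀ ^ 2 + e ^ 2) / (((k₀ ^ 2 + e ^ 2 : ℝ)) : ℂ) * (I * k₀ + e)) (matsubaraFreq β M i) e *
          (Ψ (matsubaraFreq β M i + q₀) (e + δ e) - Ψ (matsubaraFreq β M i) e) := by
    simp only [klfb_prop]
  rw [hform]
  refine main.trans (le_of_eq ?_)
  have hπ : Real.pi ≠ 0 := Real.pi_pos.ne'
  rw [hA]
  field_simp
  ring

end Shift

end Summit.HubbardSuperconductivity.HubbardSuperconductivity.Theorems.KLRegimeSplit

end
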